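import Literature.NumberTheory.DiophantineApproximation.DiscrepancyOrderStatistics
import Mathlib.Algebra.Order.Rearrangement
import Mathlib.Order.Monotone.Monovary
import Mathlib.MeasureTheory.Integral.IntervalIntegral.Basic
import Mathlib.Tactic
import HarnessLib

/-!
# The numerical integration estimate of CDT §6.5.4 (eq. (6.24))

Calegari–Dimitrov–Tang, arXiv:2408.15403, §6.5.4 "The numerical integration" (pp. 53–54):
for a point `𝐭 ∈ P_ε^d` (box discrepancy `< ε`) and a torus point `𝐳 = e(𝛉) ∈ T^d_{𝛄,ε}`
(every variable block `𝛉^{(k)}`, `k = 0,…,l`, has discrepancy `< ε`), the weighted sum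
`Σ_j 2 t_j log|Φ_j(z_j)|`, `Φ_j = φ_{k(j)}`, is bounded by the rearrangement integral:
"Koksma's inequality and the rearrangement inequality now yield a numerical integration estimate:
`Σ_{j=1}^d 2t_j · log|Φ_j(z_j)| ≤ Σ_{j=1}^d (2j/d) g*_{𝛗,𝛄}(j/d) + O(εd) + O(1)`" (eq. (6.24)),
the right side being `d ∫₀¹ 2t · g*_{𝛗,𝛄}(t) dt` up to the same errors "by Koksma's inequality
yet again" (eqs. (6.25)–(6.26)).

We prove eq. (6.24)/(6.26) for arbitrary block functions `ψ_k` (in CDT, `ψ_k = log|φ_k(e(·))|`,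
which after the rescaling `z ↦ (1−ε)z` of §6.5.4 is real-analytic on the circle, in particular
Lipschitz and bounded) in the equivalent **symmetrised form** of the rearrangement integral,
`∫₀¹ 2t · g*(t) dt = ∬ max(g(s), g(t)) ds dt` (Theorem 52, second expression in eq. (6.5)),
which block by block reads `Σ_{k,k'} (d_k d_{k'}/d²) ∬ max(ψ_k(x), ψ_{k'}(y)) dx dy`:

* `numericalIntegration` — for `K`-Lipschitz `ψ_k` bounded by `S` on `[0,1]`,
  `Σ_j 2 t_j ψ_{k(j)}(θ_j) ≤ (1/d) Σ_{k,k'} d_k d_{k'} ∬_{[0,1]²} max(ψ_k, ψ_{k'})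
     + ε d (K + 2S) + 2K(l+1) + S`.

The proof follows the printed route with all increasing rearrangements kept finite:
the rearrangement inequality (Mathlib's `Monovary.sum_mul_comp_perm_le_sum_mul`) and the pinning
of order statistics `|t_{(j)} − j/d| ≤ ε` (`abs_orderStat_sub_le`, CDT Cor. 62; this is
`k_j* = D(j/d) + O(εD)` of §6.5.4) give `Σ_j t_j L_j ≤ Σ_j (j/d) L_{(j)} + εdS`
(`sum_mul_le_sum_rank_mul_sort`); the finite identity `Σ_j (2j−1) L_{(j)} = Σ_{a,b} max(L_a, L_b)`
(`sum_sum_max_eq`) symmetrises; the blockwise pinning `|θ^{(k)}_{(i)} − i/d_k| ≤ ε`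
(`(s^{(k)})*_ℓ = ℓ/d^{(k)} + O(ε)` of §6.5.4) moves the points to the regular grid at cost `Kε`
per term (for Lipschitz `ψ_k` this replaces the appeal to Koksma's inequality), and the
regular-grid Riemann sums of the separately `K`-Lipschitz function `max(ψ_k(x), ψ_{k'}(y))` are
within `K(d_k + d_{k'})` of `d_k d_{k'} ∬ max(ψ_k, ψ_{k'})` (`sum_sum_max_grid_le`).

No named facts.

## References

* [CalegariDimitrovTang2024] F. Calegari, V. Dimitrov, Y. Tang, *The linear independence of `1`,
  `ζ(2)`, and `L(2,χ₋₃)`*, arXiv:2408.15403, §6.5.4 eqs. (6.24)–(6.26) (pp. 53–54); §6.2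
  Corollary 62; Theorem 52 eq. (6.5).
* [CalegariDimitrovTang2025] F. Calegari, V. Dimitrov, Y. Tang, *The unbounded denominators
  conjecture*, J. Amer. Math. Soc. 38 (2025), §2.5 (arXiv:2109.09040).
-/

noncomputable section

open Finset MeasureTheory Set intervalIntegral

namespace Literature.NumberTheory.DiophantineApproximation

namespace Discrepancy

/-! ### Riemann sums of Lipschitz functions on the regular grid -/

/-- A function with `|g x − g y| ≤ K|x − y|` is continuous. [folklore] -/
theorem continuous_of_abs_sub_le {g : ℝ → ℝ} {K : ℝ} (hg : ∀ x y, |g x - g y| ≤ K * |x - y|) :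
    Continuous g := by
  have hL : LipschitzWith (Real.toNNReal K) g := LipschitzWith.of_dist_le_mul fun x y => by
    rw [Real.dist_eq, Real.dist_eq]
    exact (hg x y).trans (mul_le_mul_of_nonneg_right (Real.le_coe_toNNReal K) (abs_nonneg _))
  exact hL.continuous

/-- `0 ≤ K` for a `K`-Lipschitz bound. [folklore] -/
theorem nonneg_of_abs_sub_le {g : ℝ → ℝ} {K : ℝ} (hg : ∀ x y, |g x - g y| ≤ K * |x - y|) :
    0 ≤ K := by
  have h := hg 1 0
  rw [sub_zero, abs_one, mul_one] at h
  exact (abs_nonneg _).trans h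

/-- **Right-endpoint Riemann sums of a Lipschitz function**:
`Σ_{i<p} g((i+1)/p) ≤ p ∫₀¹ g + K`. [folklore] -/
theorem sum_grid_le_integral {g : ℝ → ℝ} {K : ℝ} (hg : ∀ x y, |g x - g y| ≤ K * |x - y|)
    (p : ℕ) :
    ∑ i ∈ range p, g ((i + 1 : ℝ) / p) ≤ p * (∫ x in (0 : ℝ)..1, g x) + K := by
  have hK0 := nonneg_of_abs_sub_le hg
  rcases Nat.eq_zero_or_pos p with hp | hp
  · subst hp; simp [hK0]
  have hpr : (0 : ℝ) < p := by exact_mod_cast hp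
  have hcont := continuous_of_abs_sub_le hg
  -- split `∫₀¹ g` over the cells `[i/p, (i+1)/p]`
  have hsplit : ∑ i ∈ range p, ∫ x in ((i : ℕ) : ℝ) / p..((i + 1 : ℕ) : ℝ) / p, g x =
      ∫ x in (0 : ℝ)..1, g x := by
    have h := intervalIntegral.sum_integral_adjacent_intervals (f := g) (μ := volume)
      (a := fun i : ℕ => (i : ℝ) / p) (n := p) (fun k _ => (hcont.intervalIntegrable _ _))
    simp only [Nat.cast_zero, zero_div, div_self hpr.ne'] at h
    rw [← h]
  -- on each cell, `(1/p)·(g((i+1)/p) − K/p) ≤ ∫_cell g`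
  have hcell : ∀ i ∈ range p, (1 / (p : ℝ)) * (g ((i + 1 : ℝ) / p) - K / p) ≤
      ∫ x in ((i : ℕ) : ℝ) / p..((i + 1 : ℕ) : ℝ) / p, g x := by
    intro i _
    have hab : ((i : ℕ) : ℝ) / p ≤ ((i + 1 : ℕ) : ℝ) / p := by
      gcongr; linarith
    have hlen : ((i + 1 : ℕ) : ℝ) / p - ((i : ℕ) : ℝ) / p = 1 / p := by
      push_cast; field_simp; ring
    calc (1 / (p : ℝ)) * (g ((i + 1 : ℝ) / p) - K / p)
        = ∫ _ in ((i : ℕ) : ℝ) / p..((i + 1 : ℕ) : ℝ) / p, (g ((i + 1 : ℝ) / p) - K / p) := by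
          rw [intervalIntegral.integral_const, hlen, smul_eq_mul]
      _ ≤ ∫ x in ((i : ℕ) : ℝ) / p..((i + 1 : ℕ) : ℝ) / p, g x := by
          refine intervalIntegral.integral_mono_on hab intervalIntegrable_const
            (hcont.intervalIntegrable _ _) fun x hx => ?_
          have h1 := hg ((i + 1 : ℝ) / p) x
          have hx2 : x ≤ ((i + 1 : ℕ) : ℝ) / p := hx.2
          have hx1 : ((i : ℕ) : ℝ) / p ≤ x := hx.1
          push_cast at hx1 hx2
          have habs : |((i : ℝ) + 1) / p - x| ≤ 1 / p := by
            rw [abs_of_nonneg (by linarith)]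
            have : ((i : ℝ) + 1) / p = (i : ℝ) / p + 1 / p := by field_simp
            linarith
          have h2 : g ((i + 1 : ℝ) / p) - g x ≤ K * (1 / p) :=
            ((le_abs_self _).trans h1).trans (mul_le_mul_of_nonneg_left habs hK0)
          have h3 : K * (1 / (p : ℝ)) = K / p := by ring
          linarith
  have hsum := Finset.sum_le_sum hcell
  rw [hsplit, ← Finset.mul_sum, Finset.sum_sub_distrib, Finset.sum_const, card_range,
    nsmul_eq_mul] at hsum
  have h4 : (p : ℝ) * (K / p) = K := by field_simp
  rw [h4] at hsum
  have h5 : ∑ i ∈ range p, g ((i + 1 : ℝ) / p) - K ≤ p * ∫ x in (0 : ℝ)..1, g x := by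
    have := mul_le_mul_of_nonneg_left hsum hpr.le
    rwa [← mul_assoc, mul_one_div_cancel hpr.ne', one_mul] at this
  linarith

/-- **Regular-grid Riemann sums in two variables**: for `f` separately `K`-Lipschitz in each
variable, `Σ_{i<p, i'<q} f((i+1)/p, (i'+1)/q) ≤ p q ∬_{[0,1]²} f + K(p + q)`. [folklore] -/
theorem sum_grid₂_le_integral {f : ℝ → ℝ → ℝ} {K : ℝ}
    (hf₁ : ∀ x x' y, |f x y - f x' y| ≤ K * |x - x'|) (hf₂ : ∀ x y y', |f x y - f x y'| ≤ K * |y - y'|)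
    (p q : ℕ) :
    ∑ i ∈ range p, ∑ i' ∈ range q, f ((i + 1 : ℝ) / p) ((i' + 1 : ℝ) / q) ≤
      p * q * (∫ x in (0 : ℝ)..1, ∫ y in (0 : ℝ)..1, f x y) + K * (p + q) := by
  -- `h x = ∫₀¹ f(x,y) dy` is `K`-Lipschitz
  have hi : ∀ x, IntervalIntegrable (f x) volume 0 1 := fun x =>
    (continuous_of_abs_sub_le (hf₂ x)).intervalIntegrable _ _
  have hLip : ∀ x x', |(∫ y in (0 : ℝ)..1, f x y) - ∫ y in (0 : ℝ)..1, f x' y| ≤ K * |x - x'| := by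
    intro x x'
    rw [← intervalIntegral.integral_sub (hi x) (hi x')]
    have := intervalIntegral.norm_integral_le_of_norm_le_const (a := (0 : ℝ)) (b := 1)
      (f := fun y => f x y - f x' y) (C := K * |x - x'|) fun y _ => by
        rw [Real.norm_eq_abs]; exact hf₁ x x' y
    simpa using this
  have hinner : ∀ x, ∑ i' ∈ range q, f x ((i' + 1 : ℝ) / q) ≤ q * (∫ y in (0 : ℝ)..1, f x y) + K :=
    fun x => sum_grid_le_integral (hf₂ x) q
  have houter : ∑ i ∈ range p, (∫ y in (0 : ℝ)..1, f ((i + 1 : ℝ) / p) y) ≤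
      p * (∫ x in (0 : ℝ)..1, ∫ y in (0 : ℝ)..1, f x y) + K :=
    sum_grid_le_integral (g := fun x => ∫ y in (0 : ℝ)..1, f x y) hLip p
  have hq0 : (0 : ℝ) ≤ q := Nat.cast_nonneg _
  calc ∑ i ∈ range p, ∑ i' ∈ range q, f ((i + 1 : ℝ) / p) ((i' + 1 : ℝ) / q)
      ≤ ∑ i ∈ range p, (q * (∫ y in (0 : ℝ)..1, f ((i + 1 : ℝ) / p) y) + K) :=
        Finset.sum_le_sum fun i _ => hinner _
    _ = q * ∑ i ∈ range p, (∫ y in (0 : ℝ)..1, f ((i + 1 : ℝ) / p) y) + p * K := by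
        rw [Finset.sum_add_distrib, Finset.sum_const, card_range, nsmul_eq_mul, Finset.mul_sum]
    _ ≤ q * (p * (∫ x in (0 : ℝ)..1, ∫ y in (0 : ℝ)..1, f x y) + K) + p * K := by gcongr
    _ = p * q * (∫ x in (0 : ℝ)..1, ∫ y in (0 : ℝ)..1, f x y) + K * (p + q) := by ring

/-! ### The symmetrisation identity `Σ_j (2j+1) y_{(j)} = Σ_{a,b} max(y_a, y_b)` -/

/-- For a monotone `y : Fin d → ℝ`, `Σ_{a,b} max(y_a, y_b) = Σ_c (2c+1) y_c` (ranks `c = 0,…,d−1`).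
[folklore] -/
theorem sum_sum_max_eq_of_monotone {d : ℕ} {y : Fin d → ℝ} (hy : Monotone y) :
    ∑ a, ∑ b, max (y a) (y b) = ∑ c : Fin d, (2 * (c : ℝ) + 1) * y c := by
  have hmax : ∀ a b, max (y a) (y b) = y (max a b) := fun a b => (hy.map_max).symm
  simp_rw [hmax]
  -- split the inner sum at `b ≤ a` / `a < b`
  have hsplit : ∀ a : Fin d, ∑ b, y (max a b) =
      ((a : ℕ) + 1 : ℝ) * y a + ∑ b, if a < b then y b else 0 := by
    intro a
    rw [← Finset.sum_filter_add_sum_filter_not univ (fun b => b ≤ a)]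
    congr 1
    · rw [Finset.sum_congr rfl (g := fun _ => y a) fun b hb => by
          rw [Finset.mem_filter] at hb; rw [max_eq_left hb.2]]
      rw [Finset.sum_const]
      have : (univ.filter fun b : Fin d => b ≤ a) = Finset.Iic a := by ext b; simp
      rw [this, Fin.card_Iic, nsmul_eq_mul]; push_cast; ring
    · rw [Finset.sum_ite, Finset.sum_const_zero, add_zero]
      have : (univ.filter fun b : Fin d => ¬b ≤ a) = univ.filter fun b : Fin d => a < b := by
        ext b; simp
      rw [this]
      exact Finset.sum_congr rfl fun b hb => by
        rw [Finset.mem_filter] at hb; rw [max_eq_right hb.2.le]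
  simp_rw [hsplit]
  rw [Finset.sum_add_distrib, Finset.sum_comm]
  -- `Σ_a [a < b] y b = b · y b`
  have hcol : ∀ b : Fin d, ∑ a, (if a < b then y b else 0) = ((b : ℕ) : ℝ) * y b := by
    intro b
    rw [← Finset.sum_filter, Finset.sum_const]
    have : (univ.filter fun a : Fin d => a < b) = Finset.Iio b := by ext a; simp
    rw [this, Fin.card_Iio, nsmul_eq_mul]
  simp_rw [hcol]
  rw [← Finset.sum_add_distrib]
  refine Finset.sum_congr rfl fun c _ => ?_
  ring

/-- For any `x : Fin d → ℝ`, `Σ_{a,b} max(x_a, x_b) = Σ_j (2j+1) x_{(j)}`, where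
`x_{(j)} = x (sort x j)` is the increasing rearrangement. [folklore] -/
theorem sum_sum_max_eq {d : ℕ} (x : Fin d → ℝ) :
    ∑ a, ∑ b, max (x a) (x b) = ∑ j : Fin d, (2 * (j : ℝ) + 1) * x (Tuple.sort x j) := by
  have h := sum_sum_max_eq_of_monotone (Tuple.monotone_sort x)
  simp only [Function.comp] at h
  rw [← h]
  symm
  calc ∑ a, ∑ b, max (x (Tuple.sort x a)) (x (Tuple.sort x b))
      = ∑ a, ∑ b, max (x (Tuple.sort x a)) (x b) :=
        Finset.sum_congr rfl fun a _ => Equiv.sum_comp (Tuple.sort x) (fun b => max (x (Tuple.sort x a)) (x b))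
    _ = ∑ a, ∑ b, max (x a) (x b) := Equiv.sum_comp (Tuple.sort x) (fun a => ∑ b, max (x a) (x b))

/-! ### The rearrangement step -/

/-- **Rearrangement inequality with pinned order statistics**: if `𝐭 ∈ [0,1]^d` has box
discrepancy `≤ ε` and `|L_j| ≤ S`, then `Σ_j t_j L_j ≤ Σ_j ((j+1)/d) L_{(j)} + ε d S`.
[cite: CalegariDimitrovTang2024, §6.5.4 proof of eq. (6.24) ("the rearrangement inequality",
with `k_j* = D(j/d) + O(εD)`)] -/
theorem sum_mul_le_sum_rank_mul_sort {d : ℕ} {t : Fin d → ℝ} (ht0 : ∀ j, 0 ≤ t j) (ht1 : ∀ j, t j ≤ 1)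
    {ε : ℝ} (htD : boxDiscrepancy t ≤ ε) (L : Fin d → ℝ) {S : ℝ} (hS : ∀ j, |L j| ≤ S) :
    ∑ j, t j * L j ≤ ∑ j : Fin d, ((j : ℕ) + 1 : ℝ) / d * L (Tuple.sort L j) + ε * d * S := by
  -- rearrangement: `Σ t_j L_j ≤ Σ t_{(j)} L_{(j)}`
  have hmono : Monovary (t ∘ Tuple.sort t) (L ∘ Tuple.sort L) :=
    (Tuple.monotone_sort t).monovary (Tuple.monotone_sort L)
  have h1 : ∑ j, t j * L j =
      ∑ j, (t ∘ Tuple.sort t) j * (L ∘ Tuple.sort L) (((Tuple.sort L)⁻¹ * Tuple.sort t) j) := by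
    rw [← Equiv.sum_comp (Tuple.sort t) (fun j => t j * L j)]
    refine Finset.sum_congr rfl fun j _ => ?_
    simp [Equiv.Perm.mul_apply]
  have h2 : ∑ j, (t ∘ Tuple.sort t) j * (L ∘ Tuple.sort L) (((Tuple.sort L)⁻¹ * Tuple.sort t) j) ≤
      ∑ j, (t ∘ Tuple.sort t) j * (L ∘ Tuple.sort L) j :=
    hmono.sum_mul_comp_perm_le_sum_mul
  -- pin `t_{(j)}` to `(j+1)/d`
  have h3 : ∀ j : Fin d, (t ∘ Tuple.sort t) j * (L ∘ Tuple.sort L) j ≤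
      ((j : ℕ) + 1 : ℝ) / d * L (Tuple.sort L j) + ε * S := by
    intro j
    have hpin := abs_orderStat_sub_le t ht0 ht1 htD j
    simp only [Function.comp]
    have : (t (Tuple.sort t j) - ((j : ℕ) + 1 : ℝ) / d) * L (Tuple.sort L j) ≤ ε * S := by
      calc (t (Tuple.sort t j) - ((j : ℕ) + 1 : ℝ) / d) * L (Tuple.sort L j)
          ≤ |(t (Tuple.sort t j) - ((j : ℕ) + 1 : ℝ) / d) * L (Tuple.sort L j)| := le_abs_self _
        _ = |t (Tuple.sort t j) - ((j : ℕ) + 1 : ℝ) / d| * |L (Tuple.sort L j)| := abs_mul _ _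
        _ ≤ ε * S := mul_le_mul hpin (hS _) (abs_nonneg _) ((abs_nonneg _).trans hpin)
    nlinarith [this]
  calc ∑ j, t j * L j ≤ ∑ j, (t ∘ Tuple.sort t) j * (L ∘ Tuple.sort L) j := h1.le.trans h2
    _ ≤ ∑ j : Fin d, (((j : ℕ) + 1 : ℝ) / d * L (Tuple.sort L j) + ε * S) :=
        Finset.sum_le_sum fun j _ => h3 j
    _ = _ := by
        rw [Finset.sum_add_distrib, Finset.sum_const, card_univ, Fintype.card_fin, nsmul_eq_mul]; ring

/-- The symmetrised form: `Σ_j 2 t_j L_j ≤ (1/d)(Σ_{a,b} max(L_a,L_b) + Σ_j L_j) + 2εdS`.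
[cite: CalegariDimitrovTang2024, §6.5.4 eq. (6.24), with Theorem 52 eq. (6.5) (symmetrised
rearrangement integral)] -/
theorem sum_two_mul_le_sum_sum_max {d : ℕ} {t : Fin d → ℝ} (ht0 : ∀ j, 0 ≤ t j) (ht1 : ∀ j, t j ≤ 1)
    {ε : ℝ} (htD : boxDiscrepancy t ≤ ε) (L : Fin d → ℝ) {S : ℝ} (hS : ∀ j, |L j| ≤ S) :
    ∑ j, 2 * t j * L j ≤
      (1 / d) * (∑ a, ∑ b, max (L a) (L b) + ∑ j, L j) + 2 * ε * d * S := by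
  have h := sum_mul_le_sum_rank_mul_sort ht0 ht1 htD L hS
  have hid : ∑ j : Fin d, ((j : ℕ) + 1 : ℝ) / d * L (Tuple.sort L j) =
      (1 / d) / 2 * (∑ a, ∑ b, max (L a) (L b) + ∑ j, L j) := by
    rw [sum_sum_max_eq L, ← Equiv.sum_comp (Tuple.sort L) L, ← Finset.sum_add_distrib,
      Finset.mul_sum]
    refine Finset.sum_congr rfl fun j _ => ?_
    ring
  have h2 : ∑ j, 2 * t j * L j = 2 * ∑ j, t j * L j := by
    rw [Finset.mul_sum]; exact Finset.sum_congr rfl fun j _ => by ring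
  rw [hid] at h
  rw [h2]
  linarith

/-! ### Blocks of variables -/

variable {d l : ℕ}

/-- Block `k` of a block assignment `blk : Fin d → Fin (l+1)` (CDT: `j ↦ k(j)`, §6.4).
[cite: CalegariDimitrovTang2024, §6.4 (p. 51)] -/
def blockOf (blk : Fin d → Fin (l + 1)) (k : Fin (l + 1)) : Finset (Fin d) :=
  univ.filter fun j => blk j = k

/-- The block size `d_k = d^{(k)}`. [cite: CalegariDimitrovTang2024, §6.5.4 (p. 53)] -/
def blockCard (blk : Fin d → Fin (l + 1)) (k : Fin (l + 1)) : ℕ := (blockOf blk k).card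

/-- The increasing enumeration of block `k`. [folklore] -/
def blockEmb (blk : Fin d → Fin (l + 1)) (k : Fin (l + 1)) : Fin (blockCard blk k) ↪o Fin d :=
  (blockOf blk k).orderEmbOfFin rfl

/-- The variable block `𝛉^{(k)}` of a torus point `𝛉`. [cite: CalegariDimitrovTang2024, §6.5.2
(p. 52)] -/
def blockVec (blk : Fin d → Fin (l + 1)) (θ : Fin d → ℝ) (k : Fin (l + 1)) :
    Fin (blockCard blk k) → ℝ := fun i => θ (blockEmb blk k i)

/-- Unfolding `blockVec`. [folklore] -/
@[simp] theorem blockVec_apply (blk : Fin d → Fin (l + 1)) (θ : Fin d → ℝ) (k : Fin (l + 1))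
    (i : Fin (blockCard blk k)) : blockVec blk θ k i = θ (blockEmb blk k i) := rfl

/-- Members of block `k` are assigned to `k`. [folklore] -/
theorem blk_blockEmb (blk : Fin d → Fin (l + 1)) (k : Fin (l + 1)) (i : Fin (blockCard blk k)) :
    blk (blockEmb blk k i) = k := by
  have h : blockEmb blk k i ∈ blockOf blk k := Finset.orderEmbOfFin_mem _ _ i
  exact (Finset.mem_filter.mp h).2

/-- Sums over all variables split into sums over the blocks. [folklore] -/
theorem sum_eq_sum_blocks (blk : Fin d → Fin (l + 1)) (F : Fin d → ℝ) :
    ∑ j, F j = ∑ k, ∑ i : Fin (blockCard blk k), F (blockEmb blk k i) := by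
  rw [← Finset.sum_fiberwise univ blk F]
  refine Finset.sum_congr rfl fun k _ => ?_
  change ∑ j ∈ blockOf blk k, F j = _
  rw [← Finset.sum_coe_sort (blockOf blk k)]
  exact (Fintype.sum_equiv ((blockOf blk k).orderIsoOfFin rfl).toEquiv
    (fun i => F (blockEmb blk k i)) (fun j => F j) (fun i => rfl)).symm

/-- The block sizes add up to `d`. [folklore] -/
theorem sum_blockCard (blk : Fin d → Fin (l + 1)) :
    ∑ k, (blockCard blk k : ℝ) = d := by
  have h := sum_eq_sum_blocks blk (fun _ => (1 : ℝ))
  simp only [Finset.sum_const, card_univ, Fintype.card_fin, nsmul_eq_mul, mul_one] at h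
  exact h.symm

/-! ### Grid points replacing a well-distributed block -/

/-- The regular grid point `(rank(i)+1)/n` replacing the coordinate `v i` (rank in increasing
order). [cite: CalegariDimitrovTang2024, §6.5.4 `(s^{(k)})*_ℓ = ℓ/d^{(k)} + O(ε)` (p. 53)] -/
def gridPt {n : ℕ} (v : Fin n → ℝ) (i : Fin n) : ℝ :=
  ((((Tuple.sort v)⁻¹ i : Fin n) : ℕ) + 1 : ℝ) / n

/-- **Pinning**: a block with box discrepancy `≤ ε` is within `ε` of the regular grid, rank by
rank. [cite: CalegariDimitrovTang2024, §6.5.4 (p. 53), via §6.2 Corollary 62] -/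
theorem abs_sub_gridPt_le {n : ℕ} (v : Fin n → ℝ) (hv0 : ∀ i, 0 ≤ v i) (hv1 : ∀ i, v i ≤ 1)
    {ε : ℝ} (hD : boxDiscrepancy v ≤ ε) (i : Fin n) : |v i - gridPt v i| ≤ ε := by
  have h := abs_orderStat_sub_le v hv0 hv1 hD ((Tuple.sort v)⁻¹ i)
  simp only [Equiv.Perm.coe_inv, Equiv.apply_symm_apply] at h
  exact h

/-- Double sums over grid points are the regular-grid double sums. [folklore] -/
theorem sum_sum_gridPt_eq {p q : ℕ} (v : Fin p → ℝ) (w : Fin q → ℝ) (F : ℝ → ℝ → ℝ) :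
    ∑ i, ∑ i', F (gridPt v i) (gridPt w i') =
      ∑ i : Fin p, ∑ i' : Fin q, F (((i : ℕ) + 1 : ℝ) / p) (((i' : ℕ) + 1 : ℝ) / q) := by
  rw [← Equiv.sum_comp (Tuple.sort v)]
  refine Finset.sum_congr rfl fun i _ => ?_
  rw [← Equiv.sum_comp (Tuple.sort w)]
  refine Finset.sum_congr rfl fun i' _ => ?_
  simp [gridPt]

/-! ### The numerical integration estimate -/

/-- The pair integral `∬_{[0,1]²} max(ψ_k(x), ψ_{k'}(y)) dx dy`.
[cite: CalegariDimitrovTang2024, Theorem 52 eq. (6.5) (symmetrised rearrangement integral)] -/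
def pairIntegral (ψ : Fin (l + 1) → ℝ → ℝ) (k k' : Fin (l + 1)) : ℝ :=
  ∫ x in (0 : ℝ)..1, ∫ y in (0 : ℝ)..1, max (ψ k x) (ψ k' y)

/-- **Blockwise regular-grid bound**: the double sum of `max(ψ_k, ψ_{k'})` over the grid points
`((i+1)/p, (i'+1)/q)` is at most `p q ∬ max(ψ_k,ψ_{k'}) + K(p + q)`. [folklore] -/
theorem sum_sum_max_grid_le (ψ : Fin (l + 1) → ℝ → ℝ) {K : ℝ}
    (hK : ∀ k x y, |ψ k x - ψ k y| ≤ K * |x - y|) (k k' : Fin (l + 1)) (p q : ℕ) :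
    ∑ i : Fin p, ∑ i' : Fin q, max (ψ k (((i : ℕ) + 1 : ℝ) / p)) (ψ k' (((i' : ℕ) + 1 : ℝ) / q)) ≤
      p * q * pairIntegral ψ k k' + K * (p + q) := by
  have h := sum_grid₂_le_integral (f := fun x y => max (ψ k x) (ψ k' y)) (K := K)
    (fun x x' y => (abs_max_sub_max_le_abs _ _ _).trans (hK k x x'))
    (fun x y y' => by
      rw [max_comm (ψ k x) (ψ k' y), max_comm (ψ k x) (ψ k' y')]
      exact (abs_max_sub_max_le_abs _ _ _).trans (hK k' y y')) p q
  have inner : ∀ c : ℝ, ∑ i' : Fin q, max c (ψ k' (((i' : ℕ) + 1 : ℝ) / q)) =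
      ∑ i' ∈ range q, max c (ψ k' ((i' + 1 : ℝ) / q)) := fun c =>
    Fin.sum_univ_eq_sum_range (fun i' => max c (ψ k' ((i' + 1 : ℝ) / q))) q
  simp_rw [inner]
  rw [Fin.sum_univ_eq_sum_range (fun i => ∑ i' ∈ range q, max (ψ k ((i + 1 : ℝ) / p))
    (ψ k' ((i' + 1 : ℝ) / q))) p]
  exact h

/-- **CDT eq. (6.24)/(6.26), symmetrised form (the numerical integration estimate).**
Let `ψ_0,…,ψ_l` be `K`-Lipschitz functions bounded by `S` on `[0,1]`, `blk` a block assignment of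
the `d` variables with block sizes `d_k`, `𝛉 ∈ [0,1]^d` a torus point all of whose blocks
`𝛉^{(k)}` have box discrepancy `≤ ε` (`𝐳 = e(𝛉) ∈ T^d_{𝛄,ε}`), and `𝐭 ∈ [0,1]^d` with box
discrepancy `≤ ε` (`𝐭 ∈ P_ε^d`). Then
`Σ_j 2 t_j ψ_{k(j)}(θ_j) ≤ (1/d) Σ_{k,k'} d_k d_{k'} ∬ max(ψ_k(x), ψ_{k'}(y)) dx dy
   + ε d (K + 2S) + 2K(l+1) + S`.
(In CDT `ψ_k = log|φ_k(e(·))|`; with `d_k/d → (γ_{k+1}−γ_k)/m` the main term is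
`d ∬ max(g_{𝛗,𝛄}(s), g_{𝛗,𝛄}(t)) ds dt = d ∫₀¹ 2t·g*_{𝛗,𝛄}(t) dt`.)
[cite: CalegariDimitrovTang2024, §6.5.4 eqs. (6.24)–(6.26) (pp. 53–54)] -/
theorem numericalIntegration (blk : Fin d → Fin (l + 1)) (ψ : Fin (l + 1) → ℝ → ℝ) {K S ε : ℝ}
    (hK : ∀ k x y, |ψ k x - ψ k y| ≤ K * |x - y|) (hS : ∀ k, ∀ x ∈ Icc (0 : ℝ) 1, |ψ k x| ≤ S)
    {θ : Fin d → ℝ} (hθ0 : ∀ j, 0 ≤ θ j) (hθ1 : ∀ j, θ j ≤ 1)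
    (hθD : ∀ k, boxDiscrepancy (blockVec blk θ k) ≤ ε)
    {t : Fin d → ℝ} (ht0 : ∀ j, 0 ≤ t j) (ht1 : ∀ j, t j ≤ 1) (htD : boxDiscrepancy t ≤ ε) :
    ∑ j, 2 * t j * ψ (blk j) (θ j) ≤
      (1 / d) * ∑ k, ∑ k', (blockCard blk k : ℝ) * blockCard blk k' * pairIntegral ψ k k'
        + ε * d * (K + 2 * S) + 2 * K * (l + 1) + S := by
  have hK0 : 0 ≤ K := nonneg_of_abs_sub_le (hK 0)
  have hLS : ∀ j, |ψ (blk j) (θ j)| ≤ S := fun j => hS _ _ ⟨hθ0 j, hθ1 j⟩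
  have hS0 : 0 ≤ S := (abs_nonneg _).trans (hS 0 0 ⟨le_rfl, zero_le_one⟩)
  -- Step 1: rearrangement + symmetrisation
  have h1 := sum_two_mul_le_sum_sum_max ht0 ht1 htD (fun j => ψ (blk j) (θ j)) hLS
  -- Step 2: `Σ_j L_j ≤ d S`
  have h2 : ∑ j, ψ (blk j) (θ j) ≤ d * S := by
    calc ∑ j, ψ (blk j) (θ j) ≤ ∑ _j : Fin d, S :=
          Finset.sum_le_sum fun j _ => (le_abs_self _).trans (hLS j)
      _ = d * S := by rw [Finset.sum_const, card_univ, Fintype.card_fin, nsmul_eq_mul]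
  -- Step 3: blockwise, move the points to the regular grid and integrate
  have hpt : ∀ k (i : Fin (blockCard blk k)),
      |ψ (blk (blockEmb blk k i)) (θ (blockEmb blk k i)) - ψ k (gridPt (blockVec blk θ k) i)| ≤ K * ε := by
    intro k i
    rw [blk_blockEmb blk k i]
    have hg := abs_sub_gridPt_le (blockVec blk θ k) (fun s => hθ0 _) (fun s => hθ1 _) (hθD k) i
    rw [blockVec_apply] at hg
    exact (hK k _ _).trans (mul_le_mul_of_nonneg_left hg hK0)
  have h3 : ∑ a, ∑ b, max (ψ (blk a) (θ a)) (ψ (blk b) (θ b)) ≤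
      ∑ k, ∑ k', ((blockCard blk k : ℝ) * blockCard blk k' * pairIntegral ψ k k' +
        K * (blockCard blk k + blockCard blk k') + (blockCard blk k : ℝ) * blockCard blk k' * (K * ε)) := by
    rw [sum_eq_sum_blocks blk (fun a => ∑ b, max (ψ (blk a) (θ a)) (ψ (blk b) (θ b)))]
    refine Finset.sum_le_sum fun k _ => ?_
    have hre : ∑ i : Fin (blockCard blk k), ∑ b, max (ψ (blk (blockEmb blk k i)) (θ (blockEmb blk k i))) (ψ (blk b) (θ b)) =
        ∑ k', ∑ i : Fin (blockCard blk k), ∑ i' : Fin (blockCard blk k'),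
          max (ψ (blk (blockEmb blk k i)) (θ (blockEmb blk k i)))
            (ψ (blk (blockEmb blk k' i')) (θ (blockEmb blk k' i'))) := by
      rw [Finset.sum_comm]
      rw [sum_eq_sum_blocks blk (fun b => ∑ i : Fin (blockCard blk k),
        max (ψ (blk (blockEmb blk k i)) (θ (blockEmb blk k i))) (ψ (blk b) (θ b)))]
      exact Finset.sum_congr rfl fun k' _ => Finset.sum_comm
    rw [hre]
    refine Finset.sum_le_sum fun k' _ => ?_
    have hterm : ∀ (i : Fin (blockCard blk k)) (i' : Fin (blockCard blk k')),
        max (ψ (blk (blockEmb blk k i)) (θ (blockEmb blk k i)))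
            (ψ (blk (blockEmb blk k' i')) (θ (blockEmb blk k' i'))) ≤
          max (ψ k (gridPt (blockVec blk θ k) i)) (ψ k' (gridPt (blockVec blk θ k') i')) + K * ε := by
      intro i i'
      have ha := abs_le.mp (hpt k i)
      have hb := abs_le.mp (hpt k' i')
      rcases le_total (ψ k (gridPt (blockVec blk θ k) i)) (ψ k' (gridPt (blockVec blk θ k') i')) with hh | hh
      · rw [max_eq_right hh]; exact max_le (by linarith) (by linarith)
      · rw [max_eq_left hh]; exact max_le (by linarith) (by linarith)
    have hgrid := sum_sum_max_grid_le ψ hK k k' (blockCard blk k) (blockCard blk k')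
    rw [← sum_sum_gridPt_eq (blockVec blk θ k) (blockVec blk θ k') (fun x y => max (ψ k x) (ψ k' y))]
      at hgrid
    calc ∑ i : Fin (blockCard blk k), ∑ i' : Fin (blockCard blk k'),
          max (ψ (blk (blockEmb blk k i)) (θ (blockEmb blk k i)))
            (ψ (blk (blockEmb blk k' i')) (θ (blockEmb blk k' i')))
        ≤ ∑ i : Fin (blockCard blk k), ∑ i' : Fin (blockCard blk k'),
            (max (ψ k (gridPt (blockVec blk θ k) i)) (ψ k' (gridPt (blockVec blk θ k') i')) + K * ε) :=
          Finset.sum_le_sum fun i _ => Finset.sum_le_sum fun i' _ => hterm i i'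
      _ = ∑ i : Fin (blockCard blk k), ∑ i' : Fin (blockCard blk k'),
            max (ψ k (gridPt (blockVec blk θ k) i)) (ψ k' (gridPt (blockVec blk θ k') i')) +
            (blockCard blk k : ℝ) * blockCard blk k' * (K * ε) := by
          have e : ∀ i : Fin (blockCard blk k), ∑ i' : Fin (blockCard blk k'),
              (max (ψ k (gridPt (blockVec blk θ k) i)) (ψ k' (gridPt (blockVec blk θ k') i')) + K * ε) =
              ∑ i' : Fin (blockCard blk k'),
                max (ψ k (gridPt (blockVec blk θ k) i)) (ψ k' (gridPt (blockVec blk θ k') i')) +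
                (blockCard blk k' : ℝ) * (K * ε) := by
            intro i
            rw [Finset.sum_add_distrib, Finset.sum_const, card_univ, Fintype.card_fin, nsmul_eq_mul]
          rw [Finset.sum_congr rfl fun i _ => e i, Finset.sum_add_distrib, Finset.sum_const, card_univ,
            Fintype.card_fin, nsmul_eq_mul]
          ring
      _ ≤ (blockCard blk k : ℝ) * blockCard blk k' * pairIntegral ψ k k' +
            K * (blockCard blk k + blockCard blk k') + (blockCard blk k : ℝ) * blockCard blk k' * (K * ε) := by
          linarith
  -- Step 4: add up the constants
  have hsumd : ∑ k, (blockCard blk k : ℝ) = d := sum_blockCard blk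
  have e1 : ∑ k : Fin (l + 1), ∑ k' : Fin (l + 1), K * ((blockCard blk k : ℝ) + blockCard blk k') =
      2 * K * (l + 1) * d := by
    have hA : ∀ k : Fin (l + 1), ∑ k' : Fin (l + 1), K * ((blockCard blk k : ℝ) + blockCard blk k') =
        K * ((l + 1) * blockCard blk k + d) := by
      intro k
      rw [← Finset.mul_sum, Finset.sum_add_distrib, Finset.sum_const, card_univ, Fintype.card_fin,
        nsmul_eq_mul, hsumd]
      push_cast; ring
    rw [Finset.sum_congr rfl fun k _ => hA k, ← Finset.mul_sum, Finset.sum_add_distrib,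
      Finset.sum_const, card_univ, Fintype.card_fin, nsmul_eq_mul, ← Finset.mul_sum, hsumd]
    push_cast; ring
  have e2 : ∑ k : Fin (l + 1), ∑ k' : Fin (l + 1), (blockCard blk k : ℝ) * blockCard blk k' * (K * ε) =
      d * d * (K * ε) := by
    have : ∑ k : Fin (l + 1), ∑ k' : Fin (l + 1), (blockCard blk k : ℝ) * blockCard blk k' * (K * ε) =
        (∑ k : Fin (l + 1), ∑ k' : Fin (l + 1), (blockCard blk k : ℝ) * blockCard blk k') * (K * ε) := by
      rw [Finset.sum_mul]
      exact Finset.sum_congr rfl fun k _ => by rw [Finset.sum_mul]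
    rw [this, ← Finset.sum_mul_sum, hsumd]
  have h3' : ∑ a, ∑ b, max (ψ (blk a) (θ a)) (ψ (blk b) (θ b)) ≤
      ∑ k, ∑ k', (blockCard blk k : ℝ) * blockCard blk k' * pairIntegral ψ k k' +
        (2 * K * (l + 1) * d + d * d * (K * ε)) := by
    refine h3.trans (le_of_eq ?_)
    rw [← e1, ← e2, ← Finset.sum_add_distrib, ← Finset.sum_add_distrib]
    refine Finset.sum_congr rfl fun k _ => ?_
    rw [← Finset.sum_add_distrib, ← Finset.sum_add_distrib]
    refine Finset.sum_congr rfl fun k' _ => ?_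
    ring
  -- final arithmetic
  rcases Nat.eq_zero_or_pos d with hd0 | hdpos
  · subst hd0
    simp only [univ_eq_empty, sum_empty, Nat.cast_zero, div_zero, zero_mul, mul_zero, zero_add]
    have : (0 : ℝ) ≤ 2 * K * (l + 1) := by positivity
    linarith
  have hdr : (0 : ℝ) < d := by exact_mod_cast hdpos
  have hle : ∑ a, ∑ b, max (ψ (blk a) (θ a)) (ψ (blk b) (θ b)) + ∑ j, ψ (blk j) (θ j) ≤
      ∑ k, ∑ k', (blockCard blk k : ℝ) * blockCard blk k' * pairIntegral ψ k k' +
        (2 * K * (l + 1) * d + d * d * (K * ε)) + d * S := add_le_add h3' h2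
  have hmain : (1 / (d : ℝ)) * (∑ a, ∑ b, max (ψ (blk a) (θ a)) (ψ (blk b) (θ b)) + ∑ j, ψ (blk j) (θ j)) ≤
      (1 / d) * ∑ k, ∑ k', (blockCard blk k : ℝ) * blockCard blk k' * pairIntegral ψ k k' +
        2 * K * (l + 1) + d * (K * ε) + S := by
    have := mul_le_mul_of_nonneg_left hle (show (0 : ℝ) ≤ 1 / d by positivity)
    refine this.trans (le_of_eq ?_)
    field_simp
    ring
  linarith [hmain, h1]

end Discrepancy

end Literature.NumberTheory.DiophantineApproximation
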